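import Summits.BirchSwinnertonDyer.BirchSwinnertonDyer.Theses.KolyvaginDepthDoor
import Summits.BirchSwinnertonDyer.BirchSwinnertonDyer.Theorems.KolyvaginDepthDoorKNSupplyLevelOneOfStructure
import Summits.BirchSwinnertonDyer.BirchSwinnertonDyer.Theorems.KolyvaginDepthDoorKNSupplyAnalyticRankLeOne
import Literature.NumberTheory.EllipticCurves.LeadingTerm
import Literature.NumberTheory.EllipticCurves.BSDSha
import HarnessLib

/-!
# Route `KolyvaginDepthDoor`, crux `KolyvaginDepthSupplyKN` (stmt-BirchSwinnertonDyer-22820) —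
# COMPOSITION OF LINE `levelone`, SKELETON v5: the ♠ (2)-residual stub REDUCED to the bare mod-`p`
# structure statement at `(E, p, K)` (W. Zhang's Lemma 8.4 (1) + Thm. 9.1 shape WITHOUT Hypothesis ♠ (2))

Helper file of the lead prover (kdd-p1 g12; `--supports stmt-BirchSwinnertonDyer-22820 --as helper`);
it closes nothing and BSD is not proved by it.

v4 (`KolyvaginDepthDoorKNSupplyRankSplit`) confined both open stubs to analytic rank `≥ 2`, but its
residual stub still asked for the crux's whole `∃`-body on the residual class (choice of `p`, of `K`,
the frame, the signed clause). v5 moves ALL of that bookkeeping into the composition — the same ORDER OF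
CHOICES as on W. Zhang's ♠ cell (`K` first by the twist supply, `p` large and admissible on the
Kodaira–Néron cell, `Ш(E)[p] = 0` from the `Ш`-stub, `Ш(E^{(d_K)})[p] = 0` by finiteness,
`rank E^{(d_K)} ≤ 1` by GZK) — and leaves as the residual stub ONLY the per-`(E, p, K)` statement that
print would have to supply there: a level-one class `c_1(n) ≠ 0`, `n ∈ Λ`, with
`#Sel_p(E/ℚ) = p^{ν(n)+1}` or `#Sel_p(E^{(d_K)}/ℚ) = p^{ν(n)+1}`, GIVEN everything the line knows at
that point (non-CM, `ord L(E) ≥ 2`, the residual predicate, `p ≥ 5` good ordinary, `ρ̄_{E,p}` and the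
tower onto, ♠ (1) in both currencies, `K` imaginary quadratic Heegner with `d_K` odd, `≠ −3, −4`,
`p ∤ d_K`, `(d_K, N) = 1`, `Ш(E)[p] = 0`, `Ш(E^{(d_K)})[p] = 0`, `rank E^{(d_K)} ≤ 1`). That statement
is the shape of W. Zhang 2014 Lemma 8.4 (1) + Thm. 9.1 without ♠ (2); in print it is
Burungale–Castella–Grossi–Skinner 2026 Thm. 2 (`𝓜_∞ = ord_p Tam_E = 0` on the Kodaira–Néron cell, no
square-free hypothesis; needs `p` split in `K` and a `p`-optimal parametrisation) followed by
Zanarella 2019 §2 (Prop. 2.18: `𝓜_∞ = 0` iff the mod-`p` system is non-zero; Cor. 2.14 / Lemma 2.16: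
it then generates the Selmer line at every core vertex; core vertices of depth `max(r, r') − 1` by
the Čebotarev descent) — untyped in the tree.

* `kolyvaginDepthSupplyKN_of_hypotheses_residualStructure` — the v5 composition (crux BY NAME).
* `kolyvaginDepthSupplyKN_of_shaFiniteConjecture_residualStructure` — the calibration with Tate's
  `ShaFiniteConjecture` in place of the `Ш`-stub.

CONDITIONAL on its hypotheses (the `Ш`-stub at analytic rank `≥ 2` / Tate's conjecture, six print
facts, the residual structure stub); nothing is discharged; BSD is NOT proved by this.

References: [Tate1974] Conj. 1; [WZhang2014] Lemma 8.4 (1), Thm. 9.1, Hypothesis ♠; [GrossZagier1986]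
Thm. I.6.3; [BurungaleEtAl2026] Thm. 2; [Zanarella2019] Prop. 2.18, Cor. 2.14, Lemma 2.16
(arXiv:1908.09197); [BumpFriedbergHoffstein1990]; [HoffsteinLuo1997]; [Darmon2004] Thm. 3.22;
[Serre1972] §4.2; [SilvermanAEC2009] X.4.2.
-/

set_option linter.dupNamespace false

noncomputable section

open scoped Classical NumberField

namespace Summit.BirchSwinnertonDyer.BirchSwinnertonDyer.Theorems.KolyvaginDepthDoor

open Literature.NumberTheory.EllipticCurves Literature.NumberTheory.EllipticCurves.ModularForms
  WeierstrassCurve IsDedekindDomain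
open Summit.BirchSwinnertonDyer.BirchSwinnertonDyer.Theorems
open Summit.BirchSwinnertonDyer.BirchSwinnertonDyer.Theses.KolyvaginDepthDoor

/-- A finite subgroup `H ≤ G` with `#H < p`, `p` prime, meets `G[p]` trivially (private restatement
of `KolyvaginDepthDoorKNSupplyCalibration.inf_torsionBy_eq_bot_of_natCard_lt`, keeping this file out of
that file's import cone). [folklore] -/
private theorem inf_torsionBy_eq_bot_of_natCard_lt_aux' {G : Type*} [AddCommGroup G]
    (H : AddSubgroup G) [Finite H] {p : ℕ} (hp : p.Prime) (hlt : Nat.card H < p) :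
    (H ⊓ AddSubgroup.torsionBy G (p : ℤ) : AddSubgroup G) = ⊥ := by
  rw [eq_bot_iff]
  intro x hx
  obtain ⟨hxH, hxT⟩ := AddSubgroup.mem_inf.mp hx
  rw [AddSubgroup.mem_bot]
  have hpx : p • x = 0 := AddSubgroup.torsionBy.nsmul_iff.mp hxT
  set y : H := ⟨x, hxH⟩ with hy
  have hpy : p • y = 0 := Subtype.ext (by simp [hy, hpx])
  have hdvd : addOrderOf y ∣ p := addOrderOf_dvd_of_nsmul_eq_zero hpy
  rcases (Nat.dvd_prime hp).mp hdvd with h1 | hP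
  · have : y = 0 := AddMonoid.addOrderOf_eq_one_iff.mp h1
    simpa [hy] using congrArg Subtype.val this
  · exfalso
    have hcard : addOrderOf y ∣ Nat.card H := addOrderOf_dvd_natCard y
    rw [hP] at hcard
    have := Nat.le_of_dvd Nat.card_pos hcard
    omega

/-- **The composition of line `levelone`, SKELETON v5 (sorry-free): `KolyvaginDepthSupplyKN` BY NAME
from** (1′) «`Ш(E)[p] = 0` for all large `p`» on non-CM curves of analytic rank `≥ 2` (OPEN), (2) the
print facts `exists_isNewformOf ∧ HoffsteinLuo1997 ∧ BFH1990 ∧ GZK`, (2′) Gross–Zagier I.6.3 as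
`analyticRankEK_eq_one_iff_heegner_nonTorsion` (print), (3) W. Zhang 2014 Lemma 8.4 (1) / Thm. 9.1 BY
NAME (print), and (6″) THE RESIDUAL STRUCTURE STUB: for non-CM `E` of analytic rank `≥ 2` in the
♠ (2)-residual class, at every admissible `(p, K)` the line produces (all its side conditions being
hypotheses of the stub, see the module docstring), a level-one class `c_1(n) ≠ 0`, `n ∈ Λ`, with
`#Sel_p(E) = p^{ν(n)+1}` or `#Sel_p(E^{(d_K)}) = p^{ν(n)+1}` (OPEN as typed; in print = BCGS 2026
Thm. 2 + Zanarella 2019 §2). Analytic rank `≤ 1`: `kolyvaginDepthSupplyKN_body_of_analyticRank_le_one`.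
Analytic rank `≥ 2`: `K` first (`stub_heegner_field_supply_of_facts`), GZK on the twist, `p` large
admissible Kodaira–Néron (`exists_large_admissiblePrime_kodairaNeron_of_not_hasCM`), `Ш(E)[p] = 0`
(1′), `Ш(E^{(d_K)})[p] = 0` (finite of order `< p`); then the structure statement at `(E, p, K)` —
from Zhang's fact on the ♠ cell (`structure_of_lemma84`), from the stub (6″) on the residual — and
`levelOne_kolyvaginClass_rankClause_of_structure` gives the class with the signed clause. `#print
axioms` standard. CONDITIONAL; BSD is not proved by it. [cite: WZhang2014, Lemma 8.4 (1) (p. 236), Thm. 9.1 (p. 240)]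
[cite: GrossZagier1986, Thm. I.6.3 with V.§2] [cite: BurungaleEtAl2026, Thm. 2 (arXiv:2312.09301 §0.1)]
[cite: Zanarella2019, Prop. 2.18 and Cor. 2.14 (arXiv:1908.09197 §2)] [cite: Darmon2004, Thm. 3.22] -/
theorem kolyvaginDepthSupplyKN_of_hypotheses_residualStructure
    (hSha : ∀ (W : WeierstrassCurve ℚ) [W.IsElliptic] [W.IsGloballyMinimal], ¬ W.HasCM →
      2 ≤ W.analyticRank →
      ∃ B : ℕ, ∀ (p : ℕ) [Fact p.Prime], B < p →
        (W.sha ⊓ AddSubgroup.torsionBy W.galH1 (p : ℤ) : AddSubgroup W.galH1) = ⊥)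
    (hPrint : exists_isNewformOf ∧ HoffsteinLuo1997_exists_twist_L_one_ne_zero ∧
      bumpFriedbergHoffstein_exists_heegnerField_split_twist_simpleZero ∧
      rank_eq_analyticRank_of_analyticRank_le_one)
    (hGZ : ∀ (W : WeierstrassCurve ℚ) (N : ℕ) [NeZero N] (K : Type) [Field K] [NumberField K],
      analyticRankEK_eq_one_iff_heegner_nonTorsion W N K)
    (hZ : Literature.NumberTheory.EllipticCurves.WZhang2014_lemma84_exists_minimal_kolyvaginClass_one_selmerCard)
    (hStr : ∀ (W : WeierstrassCurve ℚ) [W.IsElliptic] [W.IsGloballyMinimal], ¬ W.HasCM →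
      2 ≤ W.analyticRank →
      ¬ (Squarefree (W.conductorNorm ℤ) ∨
          ∃ (ℓ₁ ℓ₂ : ℕ) (_ : Fact ℓ₁.Prime) (_ : Fact ℓ₂.Prime), ℓ₁ ≠ ℓ₂ ∧
            W.HasMultiplicativeReductionAtPrime ℓ₁ ∧ W.HasMultiplicativeReductionAtPrime ℓ₂) →
      ∀ (p : ℕ) [hp : Fact p.Prime], 5 ≤ p → W.HasGoodReductionAtPrime p →
        ¬ (p : ℤ) ∣ W.frobeniusTrace p → W.HasSurjectiveModNGaloisRep p →
        (∀ n : ℕ, W.HasSurjectiveModNGaloisRep (p ^ n : ℕ)) →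
        (∀ (ℓ : ℕ) [Fact ℓ.Prime], W.HasMultiplicativeReductionAtPrime ℓ →
          ¬ p ∣ padicValInt ℓ W.minimalDiscriminantInt) →
        (∀ v : HeightOneSpectrum (𝓞 ℚ), W.HasMultiplicativeReductionAt v →
          ¬ p ∣ W.ordMinimalDiscriminant v) →
        ∀ (K : Type) [Field K] [NumberField K], IsImaginaryQuadratic K →
          Odd (NumberField.discr K) → NumberField.discr K ≠ -3 → NumberField.discr K ≠ -4 →
          ¬ ((p : ℤ) ∣ NumberField.discr K) →
          IsCoprime (NumberField.discr K) ((W.conductorNorm ℤ : ℕ) : ℤ) →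
          ∀ [NeZero (W.conductorNorm ℤ)], SatisfiesHeegnerHypothesis (W.conductorNorm ℤ) K →
          (W.sha ⊓ AddSubgroup.torsionBy W.galH1 (p : ℤ) : AddSubgroup W.galH1) = ⊥ →
          ((W.quadraticTwist (NumberField.discr K : ℚ)).sha ⊓
              AddSubgroup.torsionBy (W.quadraticTwist (NumberField.discr K : ℚ)).galH1 (p : ℤ) :
              AddSubgroup (W.quadraticTwist (NumberField.discr K : ℚ)).galH1) = ⊥ →
          (W.quadraticTwist (NumberField.discr K : ℚ)).mordellWeilRank ≤ 1 →
          ∃ (Dt : ModularParametrizationData W (W.conductorNorm ℤ)) (β : ℤ) (ι : K →+* ℂ) (n : ℕ)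
            (d : KolyvaginHeegnerData Dt β ι n),
            KolyvaginDescent.KolSupp (Zhang2014.IsKolyvaginPrime (W.conductorNorm ℤ) W K p) n ∧
              d.kolyvaginClass hp.out 1 ≠ 0 ∧
              (Nat.card (W.selmerGroup p) = p ^ (n.primeFactors.card + 1) ∨
                Nat.card ((W.quadraticTwist (NumberField.discr K : ℚ)).selmerGroup p) =
                  p ^ (n.primeFactors.card + 1))) :
    KolyvaginDepthSupplyKN := by
  intro W _ _ hcm
  -- RANK SPLIT: analytic rank `≤ 1` is print
  by_cases hr : W.analyticRank ≤ 1
  · exact kolyvaginDepthSupplyKN_body_of_analyticRank_le_one hPrint hGZ W hcm hr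
  have h2 : 2 ≤ W.analyticRank := by omega
  obtain ⟨hmod, hHL, hBFH, hGZK⟩ := hPrint
  have hP := exists_large_admissiblePrime_kodairaNeron_of_not_hasCM W hcm
  haveI iNZ : NeZero (W.conductorNorm ℤ) := ⟨(W.conductorNorm_pos_holds).ne'⟩
  -- an auxiliary admissible prime, only to call the HK theorem (its `p`-hypotheses are idle)
  obtain ⟨p₁, hp₁, -, h5₁, hgood₁, hord₁, hsurj₁, -⟩ := hP 0
  haveI := hp₁
  -- `K` FIRST: Heegner, `d_K` odd, `≠ −3, −4`, `ord L(E^{(d_K)}) ≤ 1`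
  obtain ⟨K, iF, iN, hK, hD3, hD4, -, hH, hodd, -, hle, -⟩ :=
    stub_heegner_field_supply_of_facts hmod hHL hBFH W p₁ h5₁ hgood₁ hord₁ hsurj₁
  -- GZK on the twist: rank `≤ 1`, `Ш` finite
  have hdK0 : (NumberField.discr K : ℚ) ≠ 0 := by exact_mod_cast NumberField.discr_ne_zero K
  haveI iT := W.isElliptic_quadraticTwist hdK0
  obtain ⟨hrT, hfinT⟩ := hGZK (W.quadraticTwist (NumberField.discr K : ℚ)) hle
  have hT1 : (W.quadraticTwist (NumberField.discr K : ℚ)).mordellWeilRank ≤ 1 := by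
    rw [hrT]; exact hle
  haveI := hfinT
  -- THEN `p` large
  obtain ⟨B₁, hB₁⟩ := hSha W hcm h2
  obtain ⟨p, hp, hBp, h5, hgood, hord, hsurj, htower, hS1, hKN⟩ := hP
    (max B₁ (max (NumberField.discr K).natAbs
      (Nat.card ↥(W.quadraticTwist (NumberField.discr K : ℚ)).sha)))
  haveI := hp
  have hpP : p.Prime := hp.out
  have hB₁p : B₁ < p := lt_of_le_of_lt (le_max_left _ _) hBp
  have hdKp : (NumberField.discr K).natAbs < p :=
    lt_of_le_of_lt ((le_max_left _ _).trans (le_max_right _ _)) hBp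
  have hShaTp : Nat.card ↥(W.quadraticTwist (NumberField.discr K : ℚ)).sha < p :=
    lt_of_le_of_lt ((le_max_right _ _).trans (le_max_right _ _)) hBp
  -- `p ∤ d_K`
  have hpD : ¬ ((p : ℤ) ∣ NumberField.discr K) := by
    intro h
    have h1 : p ∣ (NumberField.discr K).natAbs := by
      have := Int.natAbs_dvd_natAbs.mpr h
      simpa using this
    have h2 := Nat.le_of_dvd (Int.natAbs_pos.mpr (NumberField.discr_ne_zero K)) h1
    omega
  -- `(d_K, N) = 1` from the Heegner hypothesis
  have hDN : IsCoprime (NumberField.discr K) ((W.conductorNorm ℤ : ℕ) : ℤ) := by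
    rw [Int.isCoprime_iff_gcd_eq_one, Int.gcd_comm]
    exact Literature.SatisfiesHeegnerHypothesis.coprime_discr hK.1 hH
  -- `Ш(E)[p] = 0` (the `Ш`-stub) and `Ш(E^{(d_K)})[p] = 0` (finite of order `< p`)
  have hshaW := hB₁ p hB₁p
  have hshaT := inf_torsionBy_eq_bot_of_natCard_lt_aux'
    (W.quadraticTwist (NumberField.discr K : ℚ)).sha hpP hShaTp
  -- the mod-`p` structure statement at `(E, p, K)`: Zhang on the ♠ cell, the stub on the residual
  have hstr : ∃ (Dt : ModularParametrizationData W (W.conductorNorm ℤ)) (β : ℤ) (ι : K →+* ℂ) (n : ℕ)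
      (d : KolyvaginHeegnerData Dt β ι n),
      KolyvaginDescent.KolSupp (Zhang2014.IsKolyvaginPrime (W.conductorNorm ℤ) W K p) n ∧
        d.kolyvaginClass hp.out 1 ≠ 0 ∧
        (Nat.card (W.selmerGroup p) = p ^ (n.primeFactors.card + 1) ∨
          Nat.card ((W.quadraticTwist (NumberField.discr K : ℚ)).selmerGroup p) =
            p ^ (n.primeFactors.card + 1)) := by
    by_cases hcell : Squarefree (W.conductorNorm ℤ) ∨
        ∃ (ℓ₁ ℓ₂ : ℕ) (_ : Fact ℓ₁.Prime) (_ : Fact ℓ₂.Prime), ℓ₁ ≠ ℓ₂ ∧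
          W.HasMultiplicativeReductionAtPrime ℓ₁ ∧ W.HasMultiplicativeReductionAtPrime ℓ₂
    · -- W. Zhang's ♠ cell: Hypothesis ♠ (2) from the split, ♠ (1) from Kodaira–Néron
      have hS2 : ¬ Squarefree (W.conductorNorm ℤ) →
          (∃ (ℓ : ℕ) (_ : Fact ℓ.Prime), W.HasMultiplicativeReductionAtPrime ℓ ∧
              ¬ p ∣ padicValInt ℓ W.minimalDiscriminantInt) ∧
            ∃ (ℓ₁ ℓ₂ : ℕ) (_ : Fact ℓ₁.Prime) (_ : Fact ℓ₂.Prime), ℓ₁ ≠ ℓ₂ ∧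
              W.HasMultiplicativeReductionAtPrime ℓ₁ ∧ W.HasMultiplicativeReductionAtPrime ℓ₂ := by
        intro hnsq
        rcases hcell with hsq | ⟨ℓ₁, ℓ₂, i₁, i₂, hne, h₁, h₂⟩
        · exact absurd hsq hnsq
        · exact ⟨⟨ℓ₁, i₁, h₁, @hS1 ℓ₁ i₁ h₁⟩, ℓ₁, ℓ₂, i₁, i₂, hne, h₁, h₂⟩
      exact structure_of_lemma84 hZ W p h5 hgood hord hsurj hS1 hS2 K hK hpD hDN hH
    · -- the residual class: stub (6″) verbatim
      exact hStr W hcm h2 hcell p h5 hgood hord hsurj htower hS1 hKN K hK hodd hD3 hD4 hpD hDN hH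
        hshaW hshaT hT1
  -- the level-one class with the signed clause, and assembly
  obtain ⟨Dt, β, ι, n, d, hsupp, hne, hclause⟩ :=
    levelOne_kolyvaginClass_rankClause_of_structure W p hsurj K hstr hshaW hshaT hT1
  exact ⟨p, hp, h5, hgood, hord, htower, hKN, K, iF, iN, hK, hD3, hD4, iNZ, hH, Dt, β, ι, n, d,
    hsupp.1, hsupp.2, hne, hclause⟩

/-- **CLASS-WIDE CALIBRATION, v5 (upper bracket).** `KolyvaginDepthSupplyKN` follows from Tate's
`ShaFiniteConjecture` (OPEN, by name; used at analytic rank `≥ 2` only), six print facts, and the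
residual structure stub (6″) (OPEN as typed; BCGS 2026 Thm. 2 + Zanarella 2019 §2 in print).
CONDITIONAL; nothing is discharged; BSD is not proved by it. [cite: Tate1974, Conj. 1]
[cite: WZhang2014, Lemma 8.4 (1), Thm. 9.1] [cite: GrossZagier1986, Thm. I.6.3] -/
theorem kolyvaginDepthSupplyKN_of_shaFiniteConjecture_residualStructure (hfin : ShaFiniteConjecture)
    (hPrint : exists_isNewformOf ∧ HoffsteinLuo1997_exists_twist_L_one_ne_zero ∧
      bumpFriedbergHoffstein_exists_heegnerField_split_twist_simpleZero ∧
      rank_eq_analyticRank_of_analyticRank_le_one)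
    (hGZ : ∀ (W : WeierstrassCurve ℚ) (N : ℕ) [NeZero N] (K : Type) [Field K] [NumberField K],
      analyticRankEK_eq_one_iff_heegner_nonTorsion W N K)
    (hZ : Literature.NumberTheory.EllipticCurves.WZhang2014_lemma84_exists_minimal_kolyvaginClass_one_selmerCard)
    (hStr : ∀ (W : WeierstrassCurve ℚ) [W.IsElliptic] [W.IsGloballyMinimal], ¬ W.HasCM →
      2 ≤ W.analyticRank →
      ¬ (Squarefree (W.conductorNorm ℤ) ∨
          ∃ (ℓ₁ ℓ₂ : ℕ) (_ : Fact ℓ₁.Prime) (_ : Fact ℓ₂.Prime), ℓ₁ ≠ ℓ₂ ∧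
            W.HasMultiplicativeReductionAtPrime ℓ₁ ∧ W.HasMultiplicativeReductionAtPrime ℓ₂) →
      ∀ (p : ℕ) [hp : Fact p.Prime], 5 ≤ p → W.HasGoodReductionAtPrime p →
        ¬ (p : ℤ) ∣ W.frobeniusTrace p → W.HasSurjectiveModNGaloisRep p →
        (∀ n : ℕ, W.HasSurjectiveModNGaloisRep (p ^ n : ℕ)) →
        (∀ (ℓ : ℕ) [Fact ℓ.Prime], W.HasMultiplicativeReductionAtPrime ℓ →
          ¬ p ∣ padicValInt ℓ W.minimalDiscriminantInt) →
        (∀ v : HeightOneSpectrum (𝓞 ℚ), W.HasMultiplicativeReductionAt v →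
          ¬ p ∣ W.ordMinimalDiscriminant v) →
        ∀ (K : Type) [Field K] [NumberField K], IsImaginaryQuadratic K →
          Odd (NumberField.discr K) → NumberField.discr K ≠ -3 → NumberField.discr K ≠ -4 →
          ¬ ((p : ℤ) ∣ NumberField.discr K) →
          IsCoprime (NumberField.discr K) ((W.conductorNorm ℤ : ℕ) : ℤ) →
          ∀ [NeZero (W.conductorNorm ℤ)], SatisfiesHeegnerHypothesis (W.conductorNorm ℤ) K →
          (W.sha ⊓ AddSubgroup.torsionBy W.galH1 (p : ℤ) : AddSubgroup W.galH1) = ⊥ →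
          ((W.quadraticTwist (NumberField.discr K : ℚ)).sha ⊓
              AddSubgroup.torsionBy (W.quadraticTwist (NumberField.discr K : ℚ)).galH1 (p : ℤ) :
              AddSubgroup (W.quadraticTwist (NumberField.discr K : ℚ)).galH1) = ⊥ →
          (W.quadraticTwist (NumberField.discr K : ℚ)).mordellWeilRank ≤ 1 →
          ∃ (Dt : ModularParametrizationData W (W.conductorNorm ℤ)) (β : ℤ) (ι : K →+* ℂ) (n : ℕ)
            (d : KolyvaginHeegnerData Dt β ι n),
            KolyvaginDescent.KolSupp (Zhang2014.IsKolyvaginPrime (W.conductorNorm ℤ) W K p) n ∧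
              d.kolyvaginClass hp.out 1 ≠ 0 ∧
              (Nat.card (W.selmerGroup p) = p ^ (n.primeFactors.card + 1) ∨
                Nat.card ((W.quadraticTwist (NumberField.discr K : ℚ)).selmerGroup p) =
                  p ^ (n.primeFactors.card + 1))) :
    KolyvaginDepthSupplyKN :=
  kolyvaginDepthSupplyKN_of_hypotheses_residualStructure
    (fun W hE _ _ _ ↦ by
      haveI : Finite W.sha := hfin W hE
      exact ⟨Nat.card ↥W.sha, fun _p hp hB ↦ inf_torsionBy_eq_bot_of_natCard_lt_aux' W.sha hp.out hB⟩)
    hPrint hGZ hZ hStr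

end Summit.BirchSwinnertonDyer.BirchSwinnertonDyer.Theorems.KolyvaginDepthDoor

end
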